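import Literature.Probability.Percolation.TwoGhostInequalityProofs
import Literature.Probability.Percolation.SiteExploration
import HarnessLib

/-!
# Hoeffding's inequality along the edge-by-edge exploration of a cluster (Cerf 2015, Prop. 4.1, bond version)

Topic `Literature/Probability/Percolation`. For Bernoulli bond percolation `P_p` on a locally
finite graph `G` and the edge-by-edge exploration `ClusterExploration.run G n o` of the cluster of
`o` (Hutchcroft's decision tree, `ClusterExploration.lean`), fix a finite set `D` of edges and
consider, after `K` steps, Cerf's statistic of the queried edges of `D`,

  `H_D = (1/(1-p)) · #{queried edges of D found closed} − (1/p) · #{queried edges of D found open}`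

(R. Cerf, *A lower bound on the two-arms exponent for critical percolation on the lattice*,
Ann. Probab. 43 (2015) 2458–2480, arXiv:1306.3105, §3 p. 6: "`h(A) = (1/(1−p))|{x ∈ A closed}| −
(1/p)|{x ∈ A open}|`", there for sites). Since every query is answered `open` with probability `p`
independently of the past (`ClusterExploration.real_run_eq`), `H_D` is a martingale transform with
increments in `[−1/p, 1/(1−p)]`, and Hoeffding's supermartingale argument gives **Proposition 4.1
of Cerf 2015 in its bond-percolation form** (the input of the Aizenman–Kesten–Newman /
Gandolfi–Grimmett–Russo estimate behind Proposition 1 of Duminil-Copin–Kozma–Tassion 2020, §7):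

  `P_p( |H_D| ≥ t and k edges of D were queried ) ≤ 2 exp(−2 p²(1−p)² t²/k)`

(`real_abs_statH_ge_le`; Cerf p. 7: "`≤ 2 exp(−(2/k) t² p² (1−p)²)`", by "the exponential
inequality of Hoeffding for sums of bounded martingale differences").

## Contents (namespace `ClusterExploration`)

* `countIn D b σ` — the number of queries of edges of `D` answered `b` in the state `σ`;
  `statH p D σ` — Cerf's statistic `H_D`; `lenIn D σ = countIn D true σ + countIn D false σ`;
* (from `TwoGhostInequalityProofs.lean`: `real_run_eq_inter_answer` — the atom `{run = σ}` refined by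
  the next answer has probability `p · P(run = σ)` / `(1−p) · P(run = σ)`; `integral_comp_run_succ` —
  one-step decomposition of `E[f(run_{k+1})]` over the atoms of time `k`);
* `integral_expStat_succ_le`, `integral_expStat_le_one` — the Hoeffding supermartingale
  `exp(λ H_D − λ² lenIn/(8p²(1−p)²))` (via `hoeffding_two_point`);
* `real_statH_ge_le`, `real_statH_le_neg_le`, `real_abs_statH_ge_le` — the tail bounds.

## References

* R. Cerf, Ann. Probab. 43 (2015), Prop. 4.1 (arXiv:1306.3105, p. 7) [Cerf2015].
* W. Hoeffding, J. Amer. Statist. Assoc. 58 (1963) 13–30, Thm. 2 [Hoeffding1963].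
* H. Duminil-Copin, G. Kozma, V. Tassion, arXiv:1902.03207, §7 (use of Cerf's argument for bond
  percolation, uniformly in `p`) [DuminilcopinKozmaTassion2020].
-/

noncomputable section

namespace Literature.Probability.Percolation

open _root_.MeasureTheory _root_.Filter
open scoped ENNReal

namespace ClusterExploration

variable {V : Type*} [DecidableEq V] {G : SimpleGraph V} [G.LocallyFinite] {n : ℕ}

/-! ## The statistic -/

/-- The number of queries of edges of `D` answered `b` (`true` = open) recorded in the state `σ`.
[cite: Cerf2015, §3 (the counts |{x ∈ A : ω(x) = 0}|, |{x ∈ A : ω(x) = 1}|)] -/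
def countIn (D : Finset (Sym2 V)) (b : Bool) (σ : State V) : ℕ :=
  (σ.hist.filter fun eb => eb.1 ∈ D ∧ eb.2 = b).length

/-- The number of queries of edges of `D` recorded in `σ`. [cite: Cerf2015, §3] -/
def lenIn (D : Finset (Sym2 V)) (σ : State V) : ℕ := countIn D true σ + countIn D false σ

/-- **Cerf's statistic** of the queried edges of `D`:
`H_D = (1/(1−p)) #{closed} − (1/p) #{open}` (Cerf 2015, §3 p. 6, for sites). [cite: Cerf2015, §3] -/
def statH (p : ℝ) (D : Finset (Sym2 V)) (σ : State V) : ℝ :=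
  (countIn D false σ : ℝ) / (1 - p) - (countIn D true σ : ℝ) / p

omit [G.LocallyFinite] in
/-- Nothing has been queried initially. [folklore] -/
@[simp] theorem countIn_init (D : Finset (Sym2 V)) (b : Bool) (o : V) : countIn D b (init o) = 0 := by
  simp [countIn, init]

/-- One more query adds one to the matching count. [folklore] -/
theorem countIn_extend {σ : State V} (h : ¬ Halted G n σ) (b b' : Bool) (D : Finset (Sym2 V)) :
    countIn D b' (extend G n σ h b) = countIn D b' σ + (if nextEdge G n σ h ∈ D ∧ b = b' then 1 else 0) := by
  simp only [countIn, hist_extend, List.filter_append, List.length_append]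
  congr 1
  by_cases hc : nextEdge G n σ h ∈ D ∧ b = b'
  · simp [hc]
  · simp [hc]

/-! ## The Hoeffding supermartingale -/

/-- The supermartingale weight `exp(λ H_D − λ² lenIn_D/(8p²(1−p)²))`. [cite: Hoeffding1963, Thm. 2 (proof)] -/
def expStat (p lam : ℝ) (D : Finset (Sym2 V)) (σ : State V) : ℝ :=
  Real.exp (lam * statH p D σ - lam ^ 2 / (8 * p ^ 2 * (1 - p) ^ 2) * lenIn D σ)

omit [G.LocallyFinite] in
/-- The weight is `1` initially. [folklore] -/
@[simp] theorem expStat_init (p lam : ℝ) (D : Finset (Sym2 V)) (o : V) : expStat p lam D (init o) = 1 := by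
  simp [expStat, statH, lenIn]

/-- **The supermartingale property of one step**: halted states keep the weight; a query outside
`D` keeps it; a query of an edge of `D` multiplies it, in conditional expectation, by
`e^{−λ²/(8p²(1−p)²)} (p e^{−λ/p} + (1−p) e^{λ/(1−p)}) ≤ 1` (Hoeffding's lemma for a Bernoulli
variable, `hoeffding_two_point`). [cite: Hoeffding1963, (4.16) and Thm. 2] -/
theorem integral_expStat_succ_le (p : unitInterval) (hp0 : 0 < (p : ℝ)) (hp1 : (p : ℝ) < 1)
    (lam : ℝ) (D : Finset (Sym2 V)) (o : V) (k : ℕ) :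
    ∫ ω, expStat p lam D (run G n o ω (k + 1)) ∂(bondPercolation G p) ≤
      ∫ ω, expStat p lam D (run G n o ω k) ∂(bondPercolation G p) := by
  classical
  rw [integral_comp_run_succ, integral_comp_run]
  refine Finset.sum_le_sum fun σ hσ => ?_
  refine mul_le_mul_of_nonneg_right ?_ measureReal_nonneg
  by_cases h : Halted G n σ
  · simp [h]
  · rw [dif_neg h]
    have h1p : 0 < 1 - (p : ℝ) := by linarith
    set c : ℝ := lam ^ 2 / (8 * (p : ℝ) ^ 2 * (1 - p) ^ 2) with hc
    have hext : ∀ b : Bool, expStat p lam D (extend G n σ h b) =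
        expStat p lam D σ * (if nextEdge G n σ h ∈ D then
          Real.exp (lam * (if b then -(1 / (p : ℝ)) else 1 / (1 - p)) - c) else 1) := by
      intro b
      unfold expStat
      by_cases hD : nextEdge G n σ h ∈ D
      · rw [if_pos hD, ← Real.exp_add]
        congr 1
        simp only [statH, lenIn, countIn_extend h, hD, true_and]
        cases b
        · simp only [Bool.false_eq_true, if_false, if_true, Nat.cast_add, Nat.cast_one, add_zero]
          rw [hc]; ring
        · simp only [if_true, Bool.true_eq_false, if_false, Nat.cast_add, Nat.cast_one, add_zero]
          rw [hc]; ring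
      · rw [if_neg hD, mul_one]
        simp only [statH, lenIn, countIn_extend h, hD, false_and, if_false, add_zero]
    rw [hext true, hext false]
    by_cases hD : nextEdge G n σ h ∈ D
    · simp only [hD, if_true]
      have hpos : 0 < expStat p lam D σ := Real.exp_pos _
      -- Hoeffding's lemma with `t = -λ/(p(1-p))`
      have hH := hoeffding_two_point p (-lam / ((p : ℝ) * (1 - p)))
      have ht1 : -lam / ((p : ℝ) * (1 - p)) * (1 - p) = -(lam / p) := by field_simp
      have ht2 : -(-lam / ((p : ℝ) * (1 - p)) * p) = lam / (1 - p) := by field_simp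
      have ht3 : (-lam / ((p : ℝ) * (1 - p))) ^ 2 / 8 = c := by rw [hc]; field_simp
      rw [ht1, ht2, ht3] at hH
      have key : (p : ℝ) * Real.exp (lam * -(1 / (p : ℝ)) - c) + (1 - p) * Real.exp (lam * (1 / (1 - p)) - c) ≤ 1 := by
        have e1 : Real.exp (lam * -(1 / (p : ℝ)) - c) = Real.exp (-(lam / p)) * Real.exp (-c) := by
          rw [← Real.exp_add]; congr 1; ring
        have e2 : Real.exp (lam * (1 / (1 - (p : ℝ))) - c) = Real.exp (lam / (1 - p)) * Real.exp (-c) := by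
          rw [← Real.exp_add]; congr 1; ring
        rw [e1, e2]
        have hfac : 0 < Real.exp (-c) := Real.exp_pos _
        calc (p : ℝ) * (Real.exp (-(lam / p)) * Real.exp (-c)) + (1 - p) * (Real.exp (lam / (1 - p)) * Real.exp (-c))
            = ((p : ℝ) * Real.exp (-(lam / p)) + (1 - p) * Real.exp (lam / (1 - p))) * Real.exp (-c) := by ring
          _ ≤ Real.exp c * Real.exp (-c) := mul_le_mul_of_nonneg_right hH hfac.le
          _ = 1 := by rw [← Real.exp_add, add_neg_cancel, Real.exp_zero]
      calc (p : ℝ) * (expStat p lam D σ * Real.exp (lam * -(1 / (p : ℝ)) - c)) +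
            (1 - p) * (expStat p lam D σ * Real.exp (lam * (1 / (1 - p)) - c))
          = expStat p lam D σ * ((p : ℝ) * Real.exp (lam * -(1 / (p : ℝ)) - c) +
              (1 - p) * Real.exp (lam * (1 / (1 - p)) - c)) := by ring
        _ ≤ expStat p lam D σ * 1 := mul_le_mul_of_nonneg_left key hpos.le
        _ = expStat p lam D σ := mul_one _
    · simp only [hD, if_false, mul_one]
      linarith

/-- **The supermartingale bound**: `E[exp(λ H_D(run_K) − λ² lenIn_D(run_K)/(8p²(1−p)²))] ≤ 1`.
[cite: Hoeffding1963, Thm. 2 (proof)] -/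
theorem integral_expStat_le_one (p : unitInterval) (hp0 : 0 < (p : ℝ)) (hp1 : (p : ℝ) < 1)
    (lam : ℝ) (D : Finset (Sym2 V)) (o : V) :
    ∀ K : ℕ, ∫ ω, expStat p lam D (run G n o ω K) ∂(bondPercolation G p) ≤ 1
  | 0 => by simp [expStat_init]
  | K + 1 => (integral_expStat_succ_le p hp0 hp1 lam D o K).trans (integral_expStat_le_one p hp0 hp1 lam D o K)

/-! ## The tail bounds (Cerf 2015, Prop. 4.1, bond version) -/

/-- Chernoff step: if on a measurable event `A` the weight is at least `m > 0`, then `P(A) ≤ 1/m`.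
[folklore] -/
theorem real_le_inv_of_le_expStat (p : unitInterval) (hp0 : 0 < (p : ℝ)) (hp1 : (p : ℝ) < 1)
    (lam : ℝ) (D : Finset (Sym2 V)) (o : V) (K : ℕ) {A : Set (Set (Sym2 V))} (hA : MeasurableSet A)
    {m : ℝ} (hm : 0 < m) (hle : ∀ ω ∈ A, m ≤ expStat p lam D (run G n o ω K)) :
    (bondPercolation G p).real A ≤ 1 / m := by
  set μ := bondPercolation G p with hμ
  have hint := integrable_comp_run (G := G) (n := n) p o K (expStat p lam D)
  have h1 : m * μ.real A = ∫ ω, A.indicator (fun _ => m) ω ∂μ := by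
    rw [integral_indicator_const _ hA, smul_eq_mul, mul_comm]
  have h2 : ∫ ω, A.indicator (fun _ => m) ω ∂μ ≤ ∫ ω, expStat p lam D (run G n o ω K) ∂μ := by
    refine integral_mono ((integrable_const m).indicator hA) hint fun ω => ?_
    by_cases hω : ω ∈ A
    · rw [Set.indicator_of_mem hω]; exact hle ω hω
    · rw [Set.indicator_of_notMem hω]; exact (Real.exp_pos _).le
  have h3 := integral_expStat_le_one (G := G) (n := n) p hp0 hp1 lam D o K
  rw [le_div_iff₀ hm, mul_comm]
  linarith

/-- **Upper tail**: `P(H_D(run_K) ≥ t, lenIn_D(run_K) = k) ≤ exp(−2p²(1−p)² t²/k)` for `t ≥ 0`,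
`k ≥ 1` (choose `λ = 4p²(1−p)² t/k`). [cite: Cerf2015, Prop 4.1] -/
theorem real_statH_ge_le (p : unitInterval) (hp0 : 0 < (p : ℝ)) (hp1 : (p : ℝ) < 1)
    (D : Finset (Sym2 V)) (o : V) (K : ℕ) {t : ℝ} (ht : 0 ≤ t) {k : ℕ} (hk : 1 ≤ k) :
    (bondPercolation G p).real {ω | t ≤ statH p D (run G n o ω K) ∧ lenIn D (run G n o ω K) = k} ≤
      Real.exp (-2 * (p : ℝ) ^ 2 * (1 - p) ^ 2 * t ^ 2 / k) := by
  classical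
  have h1p : 0 < 1 - (p : ℝ) := by linarith
  have hk0 : (0 : ℝ) < k := by exact_mod_cast hk
  set lam : ℝ := 4 * (p : ℝ) ^ 2 * (1 - p) ^ 2 * t / k with hlam
  set c : ℝ := lam ^ 2 / (8 * (p : ℝ) ^ 2 * (1 - p) ^ 2) with hc
  set m : ℝ := Real.exp (lam * t - c * k) with hmdef
  have hA : MeasurableSet {ω | t ≤ statH p D (run G n o ω K) ∧ lenIn D (run G n o ω K) = k} :=
    measurableSet_setOf_run (G := G) (n := n) o K (fun σ => t ≤ statH p D σ ∧ lenIn D σ = k)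
  have hle : ∀ ω ∈ {ω | t ≤ statH p D (run G n o ω K) ∧ lenIn D (run G n o ω K) = k},
      m ≤ expStat p lam D (run G n o ω K) := by
    rintro ω ⟨hH, hlen⟩
    rw [hmdef, expStat, hlen, ← hc]
    refine Real.exp_le_exp.2 ?_
    have hlam0 : 0 ≤ lam := by rw [hlam]; positivity
    nlinarith
  have h := real_le_inv_of_le_expStat (G := G) (n := n) p hp0 hp1 lam D o K hA (Real.exp_pos _) hle
  refine h.trans (le_of_eq ?_)
  rw [one_div, ← Real.exp_neg]
  congr 1
  rw [hc, hlam]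
  field_simp
  ring

/-- **Lower tail**: `P(H_D(run_K) ≤ −t, lenIn_D(run_K) = k) ≤ exp(−2p²(1−p)² t²/k)` (`λ = −4p²(1−p)²t/k`).
[cite: Cerf2015, Prop 4.1] -/
theorem real_statH_le_neg_le (p : unitInterval) (hp0 : 0 < (p : ℝ)) (hp1 : (p : ℝ) < 1)
    (D : Finset (Sym2 V)) (o : V) (K : ℕ) {t : ℝ} (ht : 0 ≤ t) {k : ℕ} (hk : 1 ≤ k) :
    (bondPercolation G p).real {ω | statH p D (run G n o ω K) ≤ -t ∧ lenIn D (run G n o ω K) = k} ≤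
      Real.exp (-2 * (p : ℝ) ^ 2 * (1 - p) ^ 2 * t ^ 2 / k) := by
  classical
  have h1p : 0 < 1 - (p : ℝ) := by linarith
  have hk0 : (0 : ℝ) < k := by exact_mod_cast hk
  set lam : ℝ := -(4 * (p : ℝ) ^ 2 * (1 - p) ^ 2 * t / k) with hlam
  set c : ℝ := lam ^ 2 / (8 * (p : ℝ) ^ 2 * (1 - p) ^ 2) with hc
  set m : ℝ := Real.exp (-lam * t - c * k) with hmdef
  have hA : MeasurableSet {ω | statH p D (run G n o ω K) ≤ -t ∧ lenIn D (run G n o ω K) = k} :=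
    measurableSet_setOf_run (G := G) (n := n) o K (fun σ => statH p D σ ≤ -t ∧ lenIn D σ = k)
  have hle : ∀ ω ∈ {ω | statH p D (run G n o ω K) ≤ -t ∧ lenIn D (run G n o ω K) = k},
      m ≤ expStat p lam D (run G n o ω K) := by
    rintro ω ⟨hH, hlen⟩
    rw [hmdef, expStat, hlen, ← hc]
    refine Real.exp_le_exp.2 ?_
    have hlam0 : lam ≤ 0 := by rw [hlam, neg_nonpos]; positivity
    nlinarith
  have h := real_le_inv_of_le_expStat (G := G) (n := n) p hp0 hp1 lam D o K hA (Real.exp_pos _) hle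
  refine h.trans (le_of_eq ?_)
  rw [one_div, ← Real.exp_neg]
  congr 1
  rw [hc, hlam]
  field_simp
  ring

/-- **Cerf 2015, Proposition 4.1, bond version** (two-sided): for `t ≥ 0` and `k ≥ 1`,
`P_p(|H_D(run_K)| ≥ t, lenIn_D(run_K) = k) ≤ 2 exp(−2p²(1−p)² t²/k)`. [cite: Cerf2015, Prop 4.1] -/
theorem real_abs_statH_ge_le (p : unitInterval) (hp0 : 0 < (p : ℝ)) (hp1 : (p : ℝ) < 1)
    (D : Finset (Sym2 V)) (o : V) (K : ℕ) {t : ℝ} (ht : 0 ≤ t) {k : ℕ} (hk : 1 ≤ k) :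
    (bondPercolation G p).real {ω | t ≤ |statH p D (run G n o ω K)| ∧ lenIn D (run G n o ω K) = k} ≤
      2 * Real.exp (-2 * (p : ℝ) ^ 2 * (1 - p) ^ 2 * t ^ 2 / k) := by
  have hsub : {ω | t ≤ |statH p D (run G n o ω K)| ∧ lenIn D (run G n o ω K) = k} ⊆
      {ω | t ≤ statH p D (run G n o ω K) ∧ lenIn D (run G n o ω K) = k} ∪
        {ω | statH p D (run G n o ω K) ≤ -t ∧ lenIn D (run G n o ω K) = k} := by
    rintro ω ⟨hH, hlen⟩
    rcases le_abs'.1 hH with h | h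
    · exact Or.inr ⟨h, hlen⟩
    · exact Or.inl ⟨h, hlen⟩
  calc (bondPercolation G p).real {ω | t ≤ |statH p D (run G n o ω K)| ∧ lenIn D (run G n o ω K) = k}
      ≤ (bondPercolation G p).real ({ω | t ≤ statH p D (run G n o ω K) ∧ lenIn D (run G n o ω K) = k} ∪
          {ω | statH p D (run G n o ω K) ≤ -t ∧ lenIn D (run G n o ω K) = k}) := measureReal_mono hsub
    _ ≤ _ := measureReal_union_le _ _
    _ ≤ Real.exp (-2 * (p : ℝ) ^ 2 * (1 - p) ^ 2 * t ^ 2 / k) + Real.exp (-2 * (p : ℝ) ^ 2 * (1 - p) ^ 2 * t ^ 2 / k) :=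
        add_le_add (real_statH_ge_le p hp0 hp1 D o K ht hk) (real_statH_le_neg_le p hp0 hp1 D o K ht hk)
    _ = 2 * Real.exp (-2 * (p : ℝ) ^ 2 * (1 - p) ^ 2 * t ^ 2 / k) := by ring

end ClusterExploration

end Literature.Probability.Percolation

end
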